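import Summits.QuantumFields.YangMills.Theorems.UnitScaleTiltProp7SigmaIdentityComb
import Summits.QuantumFields.YangMills.Theorems.UnitScaleTiltProp7DivSliceOfMemberDivSq
import HarnessLib

/-!
# Route `UnitScaleTilt`, crux K1 «MinimiserStabilityRegPr» (stmt-QuantumFields-19200), route-R E′ architecture (A′) «HCOW-VIA-Σ», package P-A4 —
# **THE (DV) ROW OF THE P-A2 ASSEMBLER FROM THE HCOMP-KNIT**: the displayed crude-slice row «`DIV(W, I•X) ≤ ζ·K + δ₁·ℓ⁻²·M` for every Σ-representative `X` at an
# E–L-critical printed-regular background `W`, with L-only `eV ζ δ₁`» (★p1 g18 (W2), the third hypothesis `hV` of `hPA2_of_symL1_diffL1_divSlice`) follows from the P-A4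
# member row at `RegPr` backgrounds (px19 g5's HCOMP-KNIT ★★★`div_sq_le_of_isLandauPrint_of_regPr`, DISPLAYED here as `hKnit` in its own shape) through the DV-SEAM
# ✓`Prop7DivSliceOfMemberDivSq.sum_normSq_divB_smul_I_le_of_memberDivSq`: `eV(L)` = the three `a`-windows of the knit at `d = 3`, `ζ = 0`, `δ₁(L) = 2·36⁶∕16·(3 + 27·eV²)`.

Cell `ym3-torus`, width seat `ym3-torus-px12` (gen 6; explicit-unit helper, `--supports stmt-QuantumFields-19200 --as helper`, count-neutral; NO claim on crux ∕ stub ∕ registry).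
THEOREMS ONLY (0 `def`, 0 `sorry`).  YM₃ on T³ is a ladder rung (R3), not the Clay problem; nothing here claims the member row `hKnit`, `hPA2`, `hcoS`, (A′), E′, a stub, the crux,
d = 4 or the mass gap.

WHY.  ★p1 g18's P-A2 assembler door displays three member rows on the `hcoS` binder: (S) the symmetric comb remainder, (β) the comb–sym difference, and (DV) the crude slice
`DIV ≤ ζK + δ₁ℓ⁻²M` in the lattice `divB ∕ torusT` letter at the LINEAR field `I•X`.  The (DV) row's inhabitant of record is «px19 g5 HCOMP-KNIT ∘ px12 g5 ✓`div_sq_le_of_competitorRow`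
∘ px12 g6 ✓`sum_normSq_divB_smul_I_le_of_memberDivSq` (`ζ := 0`, `δ₁ := 2C_P`)».  This file is that composition as a DOOR: the knit's conclusion is the hypothesis `hKnit`
(verbatim the signed statement of `Prop7DivSqCurvedOfRegPr.div_sq_le_of_isLandauPrint_of_regPr` at `c₀ := c₀ F.L`, quantified over its own binders), so the (DV) slot closes by
`exact hV_of_hcompKnit c₀ (fun F n K hnK a W ha h3 h4 hN hreg X hX ↦ div_sq_le_of_isLandauPrint_of_regPr F n K (c₀ F.L) ha h3 h4 hN hnK hreg X hX)` the hour the knit lands.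
Inside: `eV(L) := min ((6·C₀(3))⁻¹) (min (c₂′(3,L)∕4) (4·T(L))⁻¹)`, `T(L) = 2·3·L·(256·4·7 + 1 + 3(L+1))` (the knit's three windows at `(F.P K).d = 3`, `(F.P K).L = L`);
`RegPr F n K e W` from `W ∈ regFibrePr … e V` (lit ✓`mem_regFibrePr_iff`); the knit at `a := e`; `3 + 27e² ≤ 3 + 27eV²` (monotonicity, `0 < e ≤ eV`); then the DV-SEAM.

WHAT IS PROVED (ns `…Theorems.Prop7DivSliceRowOfHcompKnit`): `knit_windows` (the three windows at `e ≤ eV`), ★★★ `hV_of_hcompKnit`.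
HONEST SCOPE.  Packaging (one `min`, one monotonicity, two applications); the analytic content is the displayed `hKnit` (px19's knit over ✓p692842 ∘ ✓p694684 ∘ ✓p697307 ∘ …);
no estimate of Bałaban's asserted here.

References: T. Bałaban, CMP **102** (1985) 277–309 [Balaban1985Variational] ((2), (6) pp.278–279, (21) p.281, (44)–(47) p.286, Prop. 7 p.299); CMP **99** (1985) 389–434
[Balaban1985BackgroundPropagators] ((3.8), (3.11) p.392); CMP **99** (1985) 75–102 [Balaban1985RegularSpaces] ((1.38) p.82); CMP **98** (1985) 17–51 [Balaban1985Averaging]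
(Prop. 2 (52)–(54) p.26).
-/

set_option autoImplicit false
noncomputable section

open scoped BigOperators Matrix.Norms.L2Operator Matrix Topology InnerProductSpace
open Filter NormedSpace

namespace Summit.QuantumFields.YangMills.Theorems.Prop7DivSliceRowOfHcompKnit

open Literature.MathematicalPhysics.QuantumFieldTheory.Balaban1983to89
open Literature.MathematicalPhysics.QuantumFieldTheory.Balaban1983to89.T3ContinuumYM3Torus
open Literature.MathematicalPhysics.QuantumFieldTheory.Balaban1983to89.T3UnitLawDensityEML (ℰp)
open Literature.MathematicalPhysics.QuantumFieldTheory.Balaban1983to89.T3ConstrainedMinimiser (fibre)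
open Literature.MathematicalPhysics.QuantumFieldTheory.Balaban1983to89.T3PrintedRegularMinimiser
open Literature.MathematicalPhysics.QuantumFieldTheory.Balaban1983to89.T3RegularMinimiser
open Literature.MathematicalPhysics.QuantumFieldTheory.Balaban1983to89.T3Thm1Carrier
open T4Continuum BlockAveraging AveragingRT ExpMeanLog BlockAveragingEMLLinearised BlockAveragingEMLLinearisedBackground BlockAveragingEMLProp2
open T3SectALandauChart (In19)
open B7Prop2Explicit (C0 c2' C0_pos c2'_pos)
open B10Eq27TorusAxialLog (unitsField toUField)
open B9Eq39Adjoint (divB)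
open B9TorusCalculus (torusT)
open Summit.QuantumFields.YangMills.Theorems.Prop7SPrint (AvgCondPrint IsLandauPrint)
open Summit.QuantumFields.YangMills.Theorems.Prop7TPrint (expHermField)
open Summit.QuantumFields.YangMills.Theorems.Prop7SectET3HilbertLetters (toL2 DstarL2)
open Summit.QuantumFields.YangMills.Theorems.Prop7DivSliceOfMemberDivSq (sum_normSq_divB_smul_I_le_of_memberDivSq)

/-! ## §1 The knit's three `a`-windows at an L-only radius -/

/-- **THE KNIT's WINDOWS AT `e ≤ eV(L)`**: with `eV := min ((6·C₀(3))⁻¹) (min (c₂′(3,L)∕4) (4·T)⁻¹)`, `T = 2·3·L·(256·(3+1)·(3+4) + 1 + 3·(L+1))`: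
`C₀(3)·(2e) ≤ ⅓`, `4e ≤ c₂′(3,L)`, `T·(2e) ≤ ½`. [bookkeeping; cite: Balaban1985Averaging, (52) p.26] -/
theorem knit_windows {L : ℕ} {e : ℝ}
    (hle : e ≤ min (6 * C0 3)⁻¹ (min (c2' 3 L / 4)
      (4 * (2 * (3 : ℝ) * (L : ℝ) * (256 * ((3 : ℝ) + 1) * ((3 : ℝ) + 4) + 1 + (3 : ℝ) * ((L : ℝ) + 1))))⁻¹)) :
    C0 3 * (2 * e) ≤ 1 / 3 ∧ 4 * e ≤ c2' 3 L ∧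
      (2 * (3 : ℝ) * (L : ℝ) * (256 * ((3 : ℝ) + 1) * ((3 : ℝ) + 4) + 1 + (3 : ℝ) * ((L : ℝ) + 1))) * (2 * e) ≤ 1 / 2 := by
  set T : ℝ := 2 * (3 : ℝ) * (L : ℝ) * (256 * ((3 : ℝ) + 1) * ((3 : ℝ) + 4) + 1 + (3 : ℝ) * ((L : ℝ) + 1)) with hT
  have h1 : e ≤ (6 * C0 3)⁻¹ := hle.trans (min_le_left _ _)
  have h2 : e ≤ c2' 3 L / 4 := (hle.trans (min_le_right _ _)).trans (min_le_left _ _)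
  have h3 : e ≤ (4 * T)⁻¹ := (hle.trans (min_le_right _ _)).trans (min_le_right _ _)
  have hC := C0_pos 3
  have hT0 : 0 ≤ T := by rw [hT]; positivity
  refine ⟨?_, by linarith, ?_⟩
  · have hprod : (6 * C0 3) * e ≤ 1 := by
      calc (6 * C0 3) * e ≤ (6 * C0 3) * (6 * C0 3)⁻¹ := mul_le_mul_of_nonneg_left h1 (by positivity)
        _ = 1 := mul_inv_cancel₀ (by positivity)
    nlinarith
  · rcases hT0.eq_or_lt with hT00 | hTpos
    · rw [← hT00]; norm_num
    · have hprod : (4 * T) * e ≤ 1 := by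
        calc (4 * T) * e ≤ (4 * T) * (4 * T)⁻¹ := mul_le_mul_of_nonneg_left h3 (by positivity)
          _ = 1 := mul_inv_cancel₀ (by positivity)
      nlinarith

/-! ## §2 ★★★ The (DV) row from the knit -/

variable (c₀ : ℕ → ℝ) [hc₀ : ∀ L : ℕ, Fact (0 < c₀ L)]

set_option maxHeartbeats 400000 in
/-- ★★★ **THE (DV) ROW OF THE P-A2 ASSEMBLER FROM THE HCOMP-KNIT.**  Hypothesis `hKnit` = px19 g5's ★★★`Prop7DivSqCurvedOfRegPr.div_sq_le_of_isLandauPrint_of_regPr` at the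
weight `c₀ F.L`, quantified over its own binders (DISPLAYED; print: the crude slice (1.38) on print's slice (21) at a printed-regular background, via Bałaban's bubble competitor).
Conclusion = the (DV) row VERBATIM: for every `L > 1`, `B₁′ > 0` there are L-only `eV > 0`, `ζ, δ₁ ≥ 0` such that on the whole `hcoS` binder
`Σ_x Σ_{jk} |(divB_W (I•X))(x)_{jk}|² ≤ ζ·Σ_p‖ℒ_p(iX)‖² + δ₁·((L^{K−n})²)⁻¹·Σ_b‖X b‖²` — with `ζ = 0`, `δ₁ = 2·36⁶∕16·(3 + 27eV²)`.
[cite: Balaban1985RegularSpaces, (1.38) p.82; Balaban1985Variational, (21) p.281, (44)-(47) p.286, Prop. 7 p.299; Balaban1985BackgroundPropagators, (3.8), (3.11) p.392; Balaban1985Averaging, Prop. 2 p.26] -/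
theorem hV_of_hcompKnit
    (hKnit : ∀ (F : T3Family) (n K : ℕ) (hnK : n < K) (a : ℝ) (W : GaugeField (F.P K) 0 (Matrix.specialUnitaryGroup (Fin 2) ℂ)),
      0 < a → C0 (F.P K).d * (2 * a) ≤ 1 / 3 → 4 * a ≤ c2' (F.P K).d (F.P K).L →
      (2 * (F.P K).d * (F.P K).L * (256 * ((F.P K).d + 1) * ((F.P K).d + 4) + 1 + (F.P K).d * ((F.P K).L + 1))) * (2 * a) ≤ 1 / 2 →
      RegPr F n K a W → ∀ X : PBond (F.P K) 0 → Matrix (Fin 2) (Fin 2) ℂ, IsLandauPrint F n K W X →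
        ‖DstarL2 F n K (c₀ F.L) W (toL2 F K (c₀ F.L) X)‖ ^ 2 ≤ (36 : ℝ) ^ 6 / 16 * (3 + 27 * a ^ 2) * ‖toL2 F K (c₀ F.L) X‖ ^ 2) :
    ∀ (L : ℕ), 1 < L → ∀ (B₁' : ℝ), 0 < B₁' → ∃ eV ζ δ₁ : ℝ, 0 < eV ∧ 0 ≤ ζ ∧ 0 ≤ δ₁ ∧
      ∀ (F : T3Family), F.L = L → ∀ (n K : ℕ) (hnK : n < K) (e : ℝ) (V : GaugeField (F.P n) 0 (Matrix.specialUnitaryGroup (Fin 2) ℂ))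
        (W : GaugeField (F.P K) 0 (Matrix.specialUnitaryGroup (Fin 2) ℂ)) (X : PBond (F.P K) 0 → Matrix (Fin 2) (Fin 2) ℂ),
        0 < e → e ≤ eV → W ∈ regFibrePr F n K hnK.le e V →
        (∀ γ : ℝ → GaugeField (F.P K) 0 (Matrix.specialUnitaryGroup (Fin 2) ℂ), γ 0 = W → (∀ t, γ t ∈ fibre F ℰp n K hnK.le V) →
          (∀ b, DifferentiableAt ℝ (fun t => ((γ t b : Matrix.specialUnitaryGroup (Fin 2) ℂ) : Matrix (Fin 2) (Fin 2) ℂ)) 0) →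
            deriv (fun t => wilsonAction4 (γ t)) 0 = 0) →
        In19 F n K (2 * B₁' * e) W (expHermField X) X → AvgCondPrint F n K hnK.le V W X → IsLandauPrint F n K W X →
          (∑ x : Site (F.P K) 0, ∑ j : Fin 2, ∑ k : Fin 2,
              ‖(divB (torusT (F.P K) 0) (fun κ z => unitsField (toUField W) ⟨z, κ⟩) (fun κ z => Complex.I • X ⟨z, κ⟩) x) j k‖ ^ 2)
              ≤ ζ * (∑ p : Plaq (F.P K) 0, ‖((Complex.I • X ⟨p.src, p.μ⟩) + ((W ⟨p.src, p.μ⟩ : Matrix (Fin 2) (Fin 2) ℂ) * (Complex.I • X ⟨p.src.shift p.μ, p.ν⟩) * star (W ⟨p.src, p.μ⟩ : Matrix (Fin 2) (Fin 2) ℂ))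
            - (((W ⟨p.src, p.μ⟩ * W ⟨p.src.shift p.μ, p.ν⟩ * (W ⟨p.src.shift p.ν, p.μ⟩)⁻¹ : Matrix.specialUnitaryGroup (Fin 2) ℂ) : Matrix (Fin 2) (Fin 2) ℂ) * (Complex.I • X ⟨p.src.shift p.ν, p.μ⟩) * star ((W ⟨p.src, p.μ⟩ * W ⟨p.src.shift p.μ, p.ν⟩ * (W ⟨p.src.shift p.ν, p.μ⟩)⁻¹ : Matrix.specialUnitaryGroup (Fin 2) ℂ) : Matrix (Fin 2) (Fin 2) ℂ))
            - (((GaugeField.plaqHol W p : Matrix.specialUnitaryGroup (Fin 2) ℂ) : Matrix (Fin 2) (Fin 2) ℂ) * (Complex.I • X ⟨p.src, p.ν⟩) * star ((GaugeField.plaqHol W p : Matrix.specialUnitaryGroup (Fin 2) ℂ) : Matrix (Fin 2) (Fin 2) ℂ)))‖ ^ 2) + δ₁ * (((F.L : ℝ) ^ (K - n)) ^ 2)⁻¹ * (∑ b : PBond (F.P K) 0, ‖X b‖ ^ 2) := by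
  intro L hL B₁' hB₁'
  -- the L-only radius and constants
  set T : ℝ := 2 * (3 : ℝ) * (L : ℝ) * (256 * ((3 : ℝ) + 1) * ((3 : ℝ) + 4) + 1 + (3 : ℝ) * ((L : ℝ) + 1)) with hT
  set eV : ℝ := min (6 * C0 3)⁻¹ (min (c2' 3 L / 4) (4 * T)⁻¹) with heV
  have hC := C0_pos 3
  have hc2 : 0 < c2' 3 L := c2'_pos 3 L hL.le
  have hTpos : 0 < T := by
    rw [hT]
    have hL0 : (0 : ℝ) < (L : ℝ) := by exact_mod_cast (lt_trans zero_lt_one hL)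
    positivity
  have heV0 : 0 < eV := lt_min (by positivity) (lt_min (by positivity) (by positivity))
  refine ⟨eV, 0, 2 * ((36 : ℝ) ^ 6 / 16 * (3 + 27 * eV ^ 2)), heV0, le_rfl, by positivity, ?_⟩
  intro F hF n K hnK e V W X he hle hWreg _hEL _h19 _h20 h21
  -- the knit's windows in the member's letters `(F.P K).d = 3`, `(F.P K).L = F.L = L`
  obtain ⟨hα3, hα4, hαN⟩ := knit_windows (L := L) hle
  have hd : (F.P K).d = 3 := T3Family.P_d F K
  have hLK : (F.P K).L = L := hF ▸ rfl
  have hα3' : C0 (F.P K).d * (2 * e) ≤ 1 / 3 := by rw [hd]; exact hα3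
  have hα4' : 4 * e ≤ c2' (F.P K).d (F.P K).L := by rw [hd, hLK]; exact hα4
  have hαN' : (2 * (F.P K).d * (F.P K).L * (256 * ((F.P K).d + 1) * ((F.P K).d + 4) + 1 + (F.P K).d * ((F.P K).L + 1))) * (2 * e) ≤ 1 / 2 := by
    rw [hd, hLK]; push_cast; exact hαN
  -- the member row at `a := e`, weakened to the L-only constant at `eV`
  have hregE : RegPr F n K e W := ((mem_regFibrePr_iff F).1 hWreg).2
  have hmem := hKnit F n K hnK e W he hα3' hα4' hαN' hregE X h21
  have hmono : (36 : ℝ) ^ 6 / 16 * (3 + 27 * e ^ 2) ≤ (36 : ℝ) ^ 6 / 16 * (3 + 27 * eV ^ 2) := by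
    have : e ^ 2 ≤ eV ^ 2 := pow_le_pow_left₀ he.le hle 2
    nlinarith
  have hmem' : ‖DstarL2 F n K (c₀ F.L) W (toL2 F K (c₀ F.L) X)‖ ^ 2 ≤ ((36 : ℝ) ^ 6 / 16 * (3 + 27 * eV ^ 2)) * ‖toL2 F K (c₀ F.L) X‖ ^ 2 :=
    hmem.trans (mul_le_mul_of_nonneg_right hmono (sq_nonneg _))
  have hdv := sum_normSq_divB_smul_I_le_of_memberDivSq F n K (c₀ F.L) W X (by positivity) hmem'
  rw [zero_mul, zero_add]
  exact hdv

end Summit.QuantumFields.YangMills.Theorems.Prop7DivSliceRowOfHcompKnit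

end
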